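/-
Copyright: the b2b-balaban T⁴-continuum CRUX team, row NE7b OWNER lineage `t4-ne7b-p1` (gen 117). Project licence.
-/
import Mathlib.LinearAlgebra.Dual.Lemmas
import Mathlib.LinearAlgebra.FiniteDimensional.Lemmas
import Summits.QuantumFields.BalabanUV.T4Continuum.Spine.NE7b.SupTorusEffectiveActionHessianFloor

/-!
# THE FLUCTUATION EQUATION ON THE FIBRE IS UNIQUELY SOLVABLE AT EVERY FIELD, WITH THE `ℓ²` BOUND `(min(2,a) − λ)⁻¹`: for the
# linearised operator `h ↦ At h + u′(φ)·h` of the torus action at ANY field `φ` (`u′ ≥ −λ` at the values of `φ`, `λ < min(2,a)`)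
# and every source `g`, there is EXACTLY ONE `h ∈ ker Q′t` with `⟨(At + u′(φ))h, κ⟩ = ⟨g, κ⟩` for all `κ ∈ ker Q′t`
# (`P(A + N′(φ))P h = P g` in SBTL's spelling), and `(min(2,a) − λ)²·Σ h² ≤ Σ g²` — the convex-regime twin of SBTL's
# fluctuation covariance `Cf` letters, global in `φ`, mesh- and volume-free, one-sided curvature only
# (row NE7b, node U5c; (90) `response_form_floor` + finite-dimensional linear algebra (`ker Q′t ≃ its dual`) BY NAME; [folklore])

Cell `pub-balaban`, sub-cell `t4`, spine estimate NE7b (`T4WeightBudget.RelWeightBound`; the cell's OWN estimate — NOT PRINTED in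
[Bałaban 1983–89], NOT PROVED).  Crux-route work under `Spine/NE7b/` by the row OWNER (`t4-ne7b-p1` gen 117) under FREEZE (0)'s
crux-prover clause; NOTHING of Bałaban's is named as a Lean object, valued or asserted; no `T4Continuum/Support` leaf typed; no `def`,
no notation; zero `sorry`.  Imports (BY NAME): the OWNER's (90) `…SupTorusEffectiveActionHessianFloor` (`response_form_floor`; through
it (89) `torus_operator_form_coercive`, TEA `exists_clm_pairForm` ∕ `exists_clm_pair`), `Mathlib.LinearAlgebra.Dual.Lemmas`
(`Subspace.dual_finrank_eq`), `Mathlib.LinearAlgebra.FiniteDimensional.Lemmas` (`LinearMap.injective_iff_surjective_of_finrank_eq_finrank`).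

WHY (located).  SBTL's package carries, at each background in the chart, the fluctuation covariance `Cf w` — the inverse of
`P(A + N′(σ w))P` on `ker Q′` — with sup-norm letters `‖Cf w g‖ ≤ 2(N⁻¹ − c)⁻¹‖g‖` from the chart's Neumann series (two-sided
curvature, small fields).  In the convexity column the same operator is COERCIVE on the fibre at EVERY field: by (90)
`response_form_floor`, `⟨(At + u′(φ))h, h⟩ ≥ (min(2,a) − λ)·Σ h²`.  On the finite-dimensional fibre `ker Q′t` a coercive form is an
isomorphism onto the dual (injective, equal dimensions), so the fluctuation equation has exactly one solution for every source, and
testing the equation on the solution itself gives the `ℓ²` bound by Cauchy–Schwarz.  No chart, no smallness, no upper bound on `u′`.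

WHAT IS PROVED ([folklore]):
* §1 (TEA's level: finite carrier `ι`, ANY `At`, `u′`, `φ`, ANY submodule `K` of fields — the fibre) `eq_zero_of_floor_of_orthogonal`
  (a field of `K` whose linearised covector kills `K` vanishes, given a positive floor), **`existsUnique_fibre_solution`** (floor
  `m·Σ h² ≤ ⟨(At + u′(φ))h, h⟩` with `m > 0` ⟹ for every `g` there is EXACTLY ONE `h ∈ K` with
  `Σ_x ((At h) x + u′(φ x)·h x)·κ x = Σ_x g x·κ x` for all `κ ∈ K`), **`fibre_solution_bound`** (any such `h` has `m·Σ h² ≤ Σ g·h` and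
  `m²·Σ h² ≤ Σ g²`).
* §2 (the `Beta.Site` carriers, displayed actions; `At = Rf∘Aop∘Ef`, fibre `ker (Rc∘Dop∘Ef)`) THE END
  **`torus_existsUnique_fibre_fluctuation`**: `−λ ≤ u′(φ x)` at every site, `λ < min(2,a)` ⟹ for every source `g` exactly one
  `h` with zero torus block means solves the fluctuation equation against all `κ` with zero block means, and
  `(min(2,a) − λ)²·Σ_x h² ≤ Σ_x g²` — every `φ`, mesh, period, dimension.
* §3 toy.

HONEST (what this is NOT).  Finite-dimensional linear algebra + (90); the bound is in the `ℓ²` pairing (NOT SBTL's sup norm — no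
locality ∕ decay of the solution is claimed; that needs the two-sided road); constants OURS; nothing about the Gaussian fluctuation
MEASURE (whose covariance this operator inverts) is constructed; cubic periods; scalar skeleton ((A3), NC-NE7b-α UNRULED); nothing of
Bałaban's.  BY-NAME EFFECT ON THE WALL: NONE.  NE7b NOT PRINTED ∕ NOT PROVED; spine PROVED 0∕9; rung (B)+1 on a FINITE torus — NOT
infinite volume, NOT the mass gap, NOT Clay.  HONEST DEPENDENCY: continuum YM on T⁴ ⇐ BetaPertH ∧ nine spine estimates (0∕9 proved);
BetaPertH ⇐ (D1) ∧ (D4) ∧ CAP+tail; G-an2-4 gates asym, D1 and NE2∕3∕4.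
-/

set_option autoImplicit false

noncomputable section

namespace Summit.QuantumFields.BalabanUV.T4Continuum.NE7b.SupTorusFibreFluctuation

open Set Function Module
open scoped ENNReal
open Literature.MathematicalPhysics.QuantumFieldTheory.Balaban1983to89
open B6QGQLower276 (X blk B side AX)
open B5Hk103ScalarZd (nbhd)
open Beta (Site siteOf windowMap)
open SupTorusDirichletFormCoercive (torus_operator_form_coercive)
open SupTorusEffectiveAction (exists_clm_pairForm exists_clm_pair)
open SupTorusEffectiveActionHessianFloor (response_form_floor)

variable {d : ℕ}

/-! ## §1. TEA's level: a coercive form on a finite-dimensional fibre is uniquely solvable -/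

section Generic

variable {ι : Type*} [Fintype ι]

/-- **A FIBRE FIELD WHOSE LINEARISED COVECTOR KILLS THE FIBRE VANISHES** (positive floor). [folklore] -/
theorem eq_zero_of_floor_of_orthogonal (At : (ι → ℝ) →L[ℝ] (ι → ℝ)) {u' : ℝ → ℝ} {φ : ι → ℝ} {m : ℝ} (hm : 0 < m)
    (hfl : ∀ h : ι → ℝ, m * ∑ x, h x ^ 2 ≤ ∑ x, (At h x + u' (φ x) * h x) * h x) (K : Submodule ℝ (ι → ℝ)) {h : ι → ℝ}
    (hh : h ∈ K) (horth : ∀ κ ∈ K, ∑ x, (At h x + u' (φ x) * h x) * κ x = 0) : h = 0 := by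
  have h0 := hfl h
  rw [horth h hh] at h0
  have hsum : ∑ x, h x ^ 2 = 0 :=
    le_antisymm (nonpos_of_mul_nonpos_right (by linarith) hm |>.trans_eq' rfl |> fun h' => by linarith [h'])
      (Finset.sum_nonneg fun x _ => sq_nonneg _)
  funext x
  have hx := (Finset.sum_eq_zero_iff_of_nonneg fun y _ => sq_nonneg (h y)).1 hsum x (Finset.mem_univ x)
  exact pow_eq_zero_iff two_ne_zero |>.1 hx

/-- **THE FIBRE EQUATION IS UNIQUELY SOLVABLE** (finite dimension): with a floor `m·Σ h² ≤ Σ ((At h) x + u′(φ x)·h x)·h x`, `m > 0`,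
for every source `g` and every submodule `K` there is EXACTLY ONE `h ∈ K` with `Σ_x ((At h) x + u′(φ x)·h x)·κ x = Σ_x g x·κ x` for all
`κ ∈ K` (the form restricted to `K` is an injective, hence bijective, map `K → K^*`). [folklore] -/
theorem existsUnique_fibre_solution (At : (ι → ℝ) →L[ℝ] (ι → ℝ)) {u' : ℝ → ℝ} {φ : ι → ℝ} {m : ℝ} (hm : 0 < m)
    (hfl : ∀ h : ι → ℝ, m * ∑ x, h x ^ 2 ≤ ∑ x, (At h x + u' (φ x) * h x) * h x) (K : Submodule ℝ (ι → ℝ)) (g : ι → ℝ) :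
    ∃! h : ι → ℝ, h ∈ K ∧ ∀ κ ∈ K, ∑ x, (At h x + u' (φ x) * h x) * κ x = ∑ x, g x * κ x := by
  classical
  obtain ⟨H, hH⟩ := exists_clm_pairForm At (fun x => u' (φ x))
  -- the form restricted to the fibre, as a linear map into the dual of the fibre
  let T : K →ₗ[ℝ] Module.Dual ℝ K :=
    { toFun := fun h => (H (h : ι → ℝ)).toLinearMap ∘ₗ K.subtype
      map_add' := fun h h' => by
        ext κ
        simp only [Submodule.coe_add, map_add, LinearMap.coe_comp, Function.comp_apply, Submodule.coe_subtype,
          ContinuousLinearMap.coe_coe, add_apply, LinearMap.add_apply]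
      map_smul' := fun c h => by
        ext κ
        simp only [Submodule.coe_smul, map_smul, LinearMap.coe_comp, Function.comp_apply, Submodule.coe_subtype,
          ContinuousLinearMap.coe_coe, smul_apply, RingHom.id_apply, LinearMap.smul_apply] }
  have hT : ∀ (h κ : K), T h κ = ∑ x, (At (h : ι → ℝ) x + u' (φ x) * (h : ι → ℝ) x) * (κ : ι → ℝ) x := fun h κ => by
    simp only [T, LinearMap.coe_mk, AddHom.coe_mk, LinearMap.coe_comp, Function.comp_apply, Submodule.coe_subtype,
      ContinuousLinearMap.coe_coe, hH]
  -- injective by the floor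
  have hinj : Function.Injective T := by
    refine (injective_iff_map_eq_zero T).2 fun h hTh => ?_
    have horth : ∀ κ ∈ K, ∑ x, (At (h : ι → ℝ) x + u' (φ x) * (h : ι → ℝ) x) * κ x = 0 := fun κ hκ => by
      have := congrArg (fun L : Module.Dual ℝ K => L ⟨κ, hκ⟩) hTh
      simpa only [hT, LinearMap.zero_apply] using this
    exact Subtype.ext (eq_zero_of_floor_of_orthogonal At hm hfl K h.2 horth)
  -- hence surjective (equal finite dimensions)
  have hsurj : Function.Surjective T :=
    (LinearMap.injective_iff_surjective_of_finrank_eq_finrank (Subspace.dual_finrank_eq).symm).1 hinj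
  -- the source functional and its preimage
  obtain ⟨L, hL⟩ := exists_clm_pair g
  obtain ⟨h, hh⟩ := hsurj (L.toLinearMap ∘ₗ K.subtype)
  refine ⟨(h : ι → ℝ), ⟨h.2, fun κ hκ => ?_⟩, fun h' hh' => ?_⟩
  · have := congrArg (fun F : Module.Dual ℝ K => F ⟨κ, hκ⟩) hh
    simpa only [hT, LinearMap.coe_comp, Function.comp_apply, Submodule.coe_subtype, ContinuousLinearMap.coe_coe, hL] using this
  · -- uniqueness: `T ⟨h′, _⟩ = T h`
    have hTh' : T ⟨h', hh'.1⟩ = L.toLinearMap ∘ₗ K.subtype := by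
      ext κ
      simp only [hT, LinearMap.coe_comp, Function.comp_apply, Submodule.coe_subtype, ContinuousLinearMap.coe_coe, hL]
      exact hh'.2 κ κ.2
    have := hinj (hTh'.trans hh.symm)
    exact congrArg Subtype.val this

/-- **THE `ℓ²` BOUND OF THE FIBRE SOLUTION**: if `h ∈ K` solves the fibre equation with source `g`, then `m·Σ h² ≤ Σ g·h` and
`m²·Σ h² ≤ Σ g²`. [folklore] -/
theorem fibre_solution_bound (At : (ι → ℝ) →L[ℝ] (ι → ℝ)) {u' : ℝ → ℝ} {φ : ι → ℝ} {m : ℝ} (hm : 0 ≤ m)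
    (hfl : ∀ h : ι → ℝ, m * ∑ x, h x ^ 2 ≤ ∑ x, (At h x + u' (φ x) * h x) * h x) (K : Submodule ℝ (ι → ℝ)) {g h : ι → ℝ}
    (hh : h ∈ K) (hsol : ∀ κ ∈ K, ∑ x, (At h x + u' (φ x) * h x) * κ x = ∑ x, g x * κ x) :
    m * ∑ x, h x ^ 2 ≤ ∑ x, g x * h x ∧ m ^ 2 * ∑ x, h x ^ 2 ≤ ∑ x, g x ^ 2 := by
  have h1 : m * ∑ x, h x ^ 2 ≤ ∑ x, g x * h x := by rw [← hsol h hh]; exact hfl h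
  refine ⟨h1, ?_⟩
  -- Cauchy–Schwarz
  have hcs : (∑ x, g x * h x) ^ 2 ≤ (∑ x, g x ^ 2) * ∑ x, h x ^ 2 := Finset.sum_mul_sq_le_sq_mul_sq Finset.univ g h
  have hδ : 0 ≤ ∑ x, h x ^ 2 := Finset.sum_nonneg fun x _ => sq_nonneg _
  have hε : 0 ≤ ∑ x, g x ^ 2 := Finset.sum_nonneg fun x _ => sq_nonneg _
  by_cases h0 : ∑ x, h x ^ 2 = 0
  · rw [h0, mul_zero]; exact hε
  · have hpos : 0 < ∑ x, h x ^ 2 := lt_of_le_of_ne hδ (Ne.symm h0)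
    have h2 : (m * ∑ x, h x ^ 2) ^ 2 ≤ (∑ x, g x ^ 2) * ∑ x, h x ^ 2 :=
      (pow_le_pow_left₀ (mul_nonneg hm hδ) h1 2).trans hcs
    have h3 : m ^ 2 * (∑ x, h x ^ 2) * ∑ x, h x ^ 2 ≤ (∑ x, g x ^ 2) * ∑ x, h x ^ 2 := by
      calc m ^ 2 * (∑ x, h x ^ 2) * ∑ x, h x ^ 2 = (m * ∑ x, h x ^ 2) ^ 2 := by ring
        _ ≤ _ := h2
    exact le_of_mul_le_mul_right h3 hpos

end Generic

/-! ## §2. The torus: the fluctuation equation on the block-average fibre, every field -/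

section Torus

variable (n : ℕ) (a : ℝ) (s : ℕ) [NeZero s]
  {Dop Aop : lp (fun _ : X d => ℝ) ∞ →L[ℝ] lp (fun _ : X d => ℝ) ∞}
  (hA : ∀ (f : lp (fun _ : X d => ℝ) ∞) (p : X d), Aop f p = ∑ r ∈ nbhd n p, AX n a p r * f r)
  {Ef : (Site d ((n + 1) * s) → ℝ) →L[ℝ] lp (fun _ : X d => ℝ) ∞}
  (hEf : ∀ (g : Site d ((n + 1) * s) → ℝ) (q : X d), Ef g q = g (siteOf d ((n + 1) * s) q))
  {Rf : lp (fun _ : X d => ℝ) ∞ →L[ℝ] (Site d ((n + 1) * s) → ℝ)}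
  (hRf : ∀ (h : lp (fun _ : X d => ℝ) ∞) (x : Site d ((n + 1) * s)), Rf h x = h (windowMap d ((n + 1) * s) x))
  {Rc : lp (fun _ : X d => ℝ) ∞ →L[ℝ] (Site d s → ℝ)}

include hA hEf hRf in
/-- **THE END: THE FLUCTUATION EQUATION ON THE TORUS FIBRE IS UNIQUELY SOLVABLE AT EVERY FIELD, `ℓ²` BOUND `(min(2,a) − λ)⁻¹`.**
`At = Rf∘Aop∘Ef` (floor `min(2,a)` by (89)), `−λ ≤ u′(φ x)` at every fine torus site, `λ < min(2,a)`; fibre = the torus fields with zero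
block means (`ker (Rc∘Dop∘Ef)`).  For every source `g` there is exactly one `h` in the fibre with
`Σ_x ((At h) x + u′(φ x)·h x)·κ x = Σ_x g x·κ x` for every `κ` in the fibre, and `(min(2,a) − λ)²·Σ_x h x² ≤ Σ_x g x²`. [folklore] -/
theorem torus_existsUnique_fibre_fluctuation {u' : ℝ → ℝ} {lam : ℝ} {φ : Site d ((n + 1) * s) → ℝ}
    (hu' : ∀ x, -lam ≤ u' (φ x)) (hγ : lam < min 2 a) (g : Site d ((n + 1) * s) → ℝ) :
    (∃! h : Site d ((n + 1) * s) → ℝ, h ∈ LinearMap.ker (((Rc.comp Dop).comp Ef).toLinearMap) ∧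
      ∀ κ ∈ LinearMap.ker (((Rc.comp Dop).comp Ef).toLinearMap),
        ∑ x, (((Rf.comp Aop).comp Ef) h x + u' (φ x) * h x) * κ x = ∑ x, g x * κ x) ∧
    ∀ h : Site d ((n + 1) * s) → ℝ, h ∈ LinearMap.ker (((Rc.comp Dop).comp Ef).toLinearMap) →
      (∀ κ ∈ LinearMap.ker (((Rc.comp Dop).comp Ef).toLinearMap),
        ∑ x, (((Rf.comp Aop).comp Ef) h x + u' (φ x) * h x) * κ x = ∑ x, g x * κ x) →
      (min 2 a - lam) ^ 2 * ∑ x, h x ^ 2 ≤ ∑ x, g x ^ 2 := by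
  have hfl := response_form_floor ((Rf.comp Aop).comp Ef) (torus_operator_form_coercive n a s hA hEf hRf) hu'
  exact ⟨existsUnique_fibre_solution ((Rf.comp Aop).comp Ef) (sub_pos.2 hγ) hfl _ g,
    fun h hh hsol => (fibre_solution_bound ((Rf.comp Aop).comp Ef) (sub_nonneg.2 hγ.le) hfl _ hh hsol).2⟩

end Torus

/-! ## §3. Toy -/

/-- Toy (§1 on one site): `At = 0`, `u′ ≡ 1`, floor `m = 1` (`1·Σ h² ≤ Σ (0 + 1·h)·h`), fibre `⊤`: the equation `h = g` has exactly one
solution. -/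
example (g : Unit → ℝ) :
    ∃! h : Unit → ℝ, h ∈ (⊤ : Submodule ℝ (Unit → ℝ)) ∧
      ∀ κ ∈ (⊤ : Submodule ℝ (Unit → ℝ)), ∑ x, ((0 : (Unit → ℝ) →L[ℝ] (Unit → ℝ)) h x + (fun _ : ℝ => (1 : ℝ)) (g x) * h x) * κ x
        = ∑ x, g x * κ x :=
  existsUnique_fibre_solution (ι := Unit) 0 (u' := fun _ : ℝ => (1 : ℝ)) (φ := g) (m := 1) one_pos (fun h => by simp [sq]) ⊤ g

end Summit.QuantumFields.BalabanUV.T4Continuum.NE7b.SupTorusFibreFluctuation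

end
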